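import Literature.AlgebraicGeometry.Resolution.DeeplyRamifiedSplit
import Mathlib.FieldTheory.PrimitiveElement
import Mathlib.FieldTheory.Galois.Basic
import Mathlib.FieldTheory.SplittingField.IsSplittingField
import Mathlib.FieldTheory.Perfect
import HarnessLib

/-!
# Root layers over a field in which a perfect ground field is algebraically closed

Topic: `Literature/AlgebraicGeometry/Resolution` (valued function fields; field-theoretic
plumbing). Groundwork for the pull-down of henselian rationality through tame extensions,
F.-V. Kuhlmann, I. Vlahu, *The relative approximation degree in valued function fields*,
Math. Z. 276 (2014) = arXiv:1304.0200, §14 (towards Temkin 2013, Thm. 3.2.3 Step 1 / Thm. 3.3.1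
= the named fact `Temkin2013RelativeCurveSmoothFibre`), whose Lemma 14.2 reads

> Since `(F^h|K,v)` and hence also its subextension `(K(y)^h|K,v)` are immediate and `(L|K,v)`
> is defectless and finite, we obtain … `[F^h.L : F^h] = [L:K] = [K(y)^h.L : K(y)^h]`.

In our use `K = C` is the relative algebraic closure of the ground field in `E = F^h` (so every
element of `E` algebraic over `C` lies in `C`), `C` is perfect, and the finite Galois `L|C` is
a ROOT LAYER `L = C(roots of P)`, `P ∈ C[X]`. The degree equality, and everything else the
pull-down needs about the compositum `M = E·L = E(roots of P)`, then follow from pure field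
theory — no defect theory: for `θ` separable algebraic over `C`, the minimal polynomial of `θ`
over `E` IS its minimal polynomial over `C` (its coefficients are polynomials in conjugates of
`θ`, algebraic over `C` and in `E`).

* `map_minpoly_eq_of_forall_isAlgebraic_mem` — `minpoly_E θ = minpoly_C θ` — PROVED;
* `finrank_adjoin_simple_eq_of_forall_isAlgebraic_mem` — `[E(θ) : E] = [C(θ) : C]` — PROVED;
* `mem_adjoin_simple_of_isAlgebraic` — for `C` perfect: an element of `E(θ)` algebraic over
  `C` lies in `C(θ)` (`E(θ) ∩ C̃ = C(θ)`) — PROVED (primitive element of `C(θ, a)` and the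
  degree equality);
* root layers `L = C(roots P)`, `M = E(roots P)` (`IntermediateField.adjoin`): finite, normal,
  Galois when `C` is perfect (`isGalois_adjoin_rootSet`, `isGalois_adjoin_rootSet_top`),
  `L ⊆ M ⊆` the subfield generated by `E ∪ L`, a common primitive element
  (`exists_adjoin_rootSet_eq_adjoin_simple`), **`[M : E] = [L : C]`**
  (`finrank_adjoin_rootSet_top_eq`, Lemma 14.2's degree equality), **`M ∩ C̃ = L`**
  (`mem_adjoin_rootSet_of_isAlgebraic`) — PROVED;
* `coe_algEquiv_apply_mem_adjoin_rootSet`, `exists_restrict_algEquiv`,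
  `algEquiv_eq_of_forall_coe_apply_eq` — every `σ ∈ Gal(M|E)` stabilizes `L` and restricts to
  an element of `Gal(L|C)`; `σ` is determined by its restriction — PROVED.

All statements are [folklore] field theory; no definitions, no named facts.

## Sources

* F.-V. Kuhlmann, I. Vlahu, Math. Z. 276 (2014) = arXiv:1304.0200, §14, Lemma 14.2 (the use).
  [KuhlmannVlahu2014]
-/

noncomputable section

open Polynomial IntermediateField Module

namespace Literature.AlgebraicGeometry.Resolution

universe u

variable {Ω : Type u} [Field Ω] [IsAlgClosed Ω]

/-! ### Minimal polynomials over a field in which the ground field is algebraically closed -/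

section Minpoly

variable {C E : Subfield Ω} (hCE : C ≤ E) (hrel : ∀ a ∈ E, IsAlgebraic C a → a ∈ C)
include hCE hrel

/-- **The minimal polynomial of a separable `θ` does not change from `C` to `E`** when every
element of `E` algebraic over `C` lies in `C`: `minpoly_E θ = minpoly_C θ` (as polynomials over
`Ω`). The monic factor `minpoly_E θ` of `minpoly_C θ` has among its roots every root of
`minpoly_C θ` (`mem_aroots_minpoly_of_forall_isAlgebraic_mem`), and the latter are
`deg minpoly_C θ` many. [folklore] -/
theorem map_minpoly_eq_of_forall_isAlgebraic_mem {θ : Ω} (hθ : IsIntegral C θ)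
    (hsep : IsSeparable C θ) :
    (minpoly E θ).map (algebraMap E Ω) = (minpoly C θ).map (algebraMap C Ω) := by
  classical
  have hθE : IsIntegral E θ := isIntegral_of_subfield_le hCE hθ
  set f := (minpoly C θ).map (algebraMap C Ω) with hf
  set g := (minpoly E θ).map (algebraMap E Ω) with hg
  have hfm : f.Monic := (minpoly.monic hθ).map _
  have hgm : g.Monic := (minpoly.monic hθE).map _
  have hdvd : g ∣ f := by
    letI : Algebra C E := (Subfield.inclusion hCE).toAlgebra
    haveI : IsScalarTower C E Ω := IsScalarTower.of_algebraMap_eq fun _ => rfl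
    have h1 : minpoly E θ ∣ (minpoly C θ).map (algebraMap C E) :=
      minpoly.dvd_map_of_isScalarTower C E θ
    have h2 := Polynomial.map_dvd (algebraMap E Ω) h1
    rwa [Polynomial.map_map, ← IsScalarTower.algebraMap_eq] at h2
  have hdeg : f.natDegree ≤ g.natDegree := by
    have hsub : f.roots.toFinset ⊆ g.roots.toFinset := by
      intro θ' hθ'
      rw [Multiset.mem_toFinset] at hθ' ⊢
      exact mem_aroots_minpoly_of_forall_isAlgebraic_mem hCE hrel hθ hθ'
    have hsep' : (minpoly C θ).Separable := hsep
    have hcardf : f.roots.toFinset.card = f.natDegree := by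
      rw [Multiset.toFinset_card_of_nodup (nodup_roots hsep'.map),
        ← (IsAlgClosed.splits f).natDegree_eq_card_roots]
    calc f.natDegree = f.roots.toFinset.card := hcardf.symm
      _ ≤ g.roots.toFinset.card := Finset.card_le_card hsub
      _ ≤ g.roots.card := Multiset.toFinset_card_le _
      _ = g.natDegree := (IsAlgClosed.splits g).natDegree_eq_card_roots.symm
  exact (Polynomial.eq_of_monic_of_dvd_of_natDegree_le hgm hfm hdvd hdeg).symm

/-- **`[E(θ) : E] = [C(θ) : C]`** for `θ` separable algebraic over `C`, when every element of
`E` algebraic over `C` lies in `C`. [folklore] -/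
theorem finrank_adjoin_simple_eq_of_forall_isAlgebraic_mem {θ : Ω} (hθ : IsIntegral C θ)
    (hsep : IsSeparable C θ) :
    finrank E (IntermediateField.adjoin E ({θ} : Set Ω)) =
      finrank C (IntermediateField.adjoin C ({θ} : Set Ω)) := by
  have hθE : IsIntegral E θ := isIntegral_of_subfield_le hCE hθ
  rw [IntermediateField.adjoin.finrank hθE, IntermediateField.adjoin.finrank hθ,
    ← natDegree_map (algebraMap E Ω), map_minpoly_eq_of_forall_isAlgebraic_mem hCE hrel hθ hsep,
    natDegree_map]

omit [IsAlgClosed Ω] hrel in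
/-- `C(s) ⊆ E(s)` for `C ≤ E` (as subsets of `Ω`). [folklore] -/
theorem coe_adjoin_subset_coe_adjoin (s : Set Ω) :
    ((IntermediateField.adjoin C s : IntermediateField C Ω) : Set Ω) ⊆
      (IntermediateField.adjoin E s : IntermediateField E Ω) := by
  rw [coe_adjoin_subfield, coe_adjoin_subfield]
  exact Subfield.closure_mono (Set.union_subset_union_left _ hCE)

omit [IsAlgClosed Ω] hCE hrel in
/-- `E(s) ⊆` the subfield generated by `E` and `C(s)`. [folklore] -/
theorem coe_adjoin_subset_closure (s : Set Ω) :
    ((IntermediateField.adjoin E s : IntermediateField E Ω) : Set Ω) ⊆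
      Subfield.closure ((E : Set Ω) ∪ (IntermediateField.adjoin C s : IntermediateField C Ω)) := by
  rw [coe_adjoin_subfield]
  refine Subfield.closure_mono (Set.union_subset_union_right _ ?_)
  exact IntermediateField.subset_adjoin C s

/-- **`E(θ) ∩ C̃ = C(θ)`** for `C` PERFECT: an element `a ∈ E(θ)` algebraic over `C` lies in
`C(θ)`. Indeed `C(θ, a) = C(η)` for a primitive `η` (separability), `E(η) = E(θ, a) = E(θ)`, so
`[C(η) : C] = [E(η) : E] = [E(θ) : E] = [C(θ) : C]` and `C(θ) = C(η) ∋ a`. [folklore] -/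
theorem mem_adjoin_simple_of_isAlgebraic [PerfectField C] {θ : Ω} (hθ : IsIntegral C θ) {a : Ω}
    (haE : a ∈ (IntermediateField.adjoin E ({θ} : Set Ω) : IntermediateField E Ω))
    (ha : IsAlgebraic C a) :
    a ∈ (IntermediateField.adjoin C ({θ} : Set Ω) : IntermediateField C Ω) := by
  classical
  set K₂ : IntermediateField C Ω := IntermediateField.adjoin C ({θ, a} : Set Ω) with hK₂def
  haveI : FiniteDimensional C K₂ := by
    refine IntermediateField.finiteDimensional_adjoin fun x hx => ?_
    rcases hx with rfl | rfl
    exacts [hθ, ha.isIntegral]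
  haveI : Algebra.IsAlgebraic C K₂ := Algebra.IsAlgebraic.of_finite C K₂
  obtain ⟨η₀, hη₀⟩ := Field.exists_primitive_element C K₂
  set η : Ω := (η₀ : Ω) with hηdef
  have hK₂η : IntermediateField.adjoin C ({η} : Set Ω) = K₂ := by
    simpa only [IntermediateField.lift_adjoin_simple, IntermediateField.lift_top] using
      congr_arg IntermediateField.lift hη₀
  have hηint : IsIntegral C η := IntermediateField.isIntegral_iff.mp (Algebra.IsIntegral.isIntegral η₀)
  have hηsep : IsSeparable C η := PerfectField.separable_of_irreducible (minpoly.irreducible hηint)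
  have hθsep : IsSeparable C θ := PerfectField.separable_of_irreducible (minpoly.irreducible hθ)
  -- `θ, a ∈ E(θ)` hence `K₂ ⊆ E(θ)` and `η ∈ E(θ)`
  have hK₂sub : (K₂ : Set Ω) ⊆ (IntermediateField.adjoin E ({θ} : Set Ω) : IntermediateField E Ω) := by
    rw [hK₂def, coe_adjoin_subfield]
    intro x hx
    refine (Subfield.closure_le (t := (IntermediateField.adjoin E ({θ} : Set Ω)).toSubfield)).mpr
      ?_ hx
    refine Set.union_subset (fun c hc => ?_) ?_
    · exact (IntermediateField.adjoin E ({θ} : Set Ω)).algebraMap_mem ⟨c, hCE hc⟩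
    · intro y hy
      rcases hy with rfl | rfl
      · exact IntermediateField.mem_adjoin_simple_self E y
      · exact haE
  -- `E(η) = E(θ)`
  have hEη : (IntermediateField.adjoin E ({η} : Set Ω) : IntermediateField E Ω) =
      IntermediateField.adjoin E ({θ} : Set Ω) := by
    apply le_antisymm
    · rw [IntermediateField.adjoin_le_iff, Set.singleton_subset_iff]
      exact hK₂sub (show η ∈ K₂ from hK₂η ▸ IntermediateField.mem_adjoin_simple_self C η)
    · rw [IntermediateField.adjoin_le_iff, Set.singleton_subset_iff]
      have hθK₂ : θ ∈ K₂ := IntermediateField.subset_adjoin C _ (Set.mem_insert θ {a})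
      rw [← hK₂η] at hθK₂
      exact coe_adjoin_subset_coe_adjoin hCE {η} hθK₂
  -- degrees
  have h1 := finrank_adjoin_simple_eq_of_forall_isAlgebraic_mem hCE hrel hηint hηsep
  have h2 := finrank_adjoin_simple_eq_of_forall_isAlgebraic_mem hCE hrel hθ hθsep
  rw [hEη, h2, hK₂η] at h1
  have hle : IntermediateField.adjoin C ({θ} : Set Ω) ≤ K₂ :=
    IntermediateField.adjoin.mono C _ _ (Set.singleton_subset_iff.mpr (Set.mem_insert θ {a}))
  have heq : IntermediateField.adjoin C ({θ} : Set Ω) = K₂ :=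
    IntermediateField.eq_of_le_of_finrank_eq hle h1
  rw [heq]
  exact IntermediateField.subset_adjoin C _ (Set.mem_insert_of_mem θ rfl)

end Minpoly

/-! ### Root layers `C(roots P) ⊆ E(roots P)` -/

section Layers

variable {C E : Subfield Ω} (hCE : C ≤ E) (P : Polynomial C)

omit [IsAlgClosed Ω] in
/-- Roots are integral over `C`. [folklore] -/
theorem isIntegral_of_mem_rootSet' {x : Ω} (hx : x ∈ P.rootSet Ω) : IsIntegral C x :=
  (isAlgebraic_of_mem_rootSet hx).isIntegral

omit [IsAlgClosed Ω] in
/-- `C(roots P)` is finite over `C`. [folklore] -/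
theorem finiteDimensional_adjoin_rootSet_subfield :
    FiniteDimensional C (IntermediateField.adjoin C (P.rootSet Ω)) :=
  IntermediateField.finiteDimensional_adjoin fun _ hx => isIntegral_of_mem_rootSet' P hx

omit [IsAlgClosed Ω] in
include hCE in
/-- `E(roots P)` is finite over `E`. [folklore] -/
theorem finiteDimensional_adjoin_rootSet_top_subfield :
    FiniteDimensional E (IntermediateField.adjoin E (P.rootSet Ω)) :=
  IntermediateField.finiteDimensional_adjoin fun _ hx =>
    isIntegral_of_subfield_le hCE (isIntegral_of_mem_rootSet' P hx)

/-- `C(roots P)` is normal over `C` (a splitting field of `P`). [folklore] -/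
theorem normal_adjoin_rootSet_subfield : Normal C (IntermediateField.adjoin C (P.rootSet Ω)) :=
  Normal.of_isSplittingField P
    (hFEp := IntermediateField.adjoin_rootSet_isSplittingField (IsAlgClosed.splits _))

include hCE in
/-- `E(roots P)` is normal over `E` (a splitting field of `P` over `E`). [folklore] -/
theorem normal_adjoin_rootSet_top_subfield : Normal E (IntermediateField.adjoin E (P.rootSet Ω)) := by
  classical
  letI : Algebra C E := (Subfield.inclusion hCE).toAlgebra
  haveI : IsScalarTower C E Ω := IsScalarTower.of_algebraMap_eq fun _ => rfl
  set P' : Polynomial E := P.map (algebraMap C E) with hP'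
  have hroots : P'.rootSet Ω = P.rootSet Ω := by
    rw [Polynomial.rootSet, Polynomial.rootSet, Polynomial.aroots_def, Polynomial.aroots_def, hP',
      Polynomial.map_map, ← IsScalarTower.algebraMap_eq]
  have hsf : P'.IsSplittingField E (IntermediateField.adjoin E (P'.rootSet Ω)) :=
    IntermediateField.adjoin_rootSet_isSplittingField (IsAlgClosed.splits _)
  rw [hroots] at hsf
  exact Normal.of_isSplittingField P'

/-- `C(roots P)|C` is Galois when `C` is perfect. [folklore] -/
theorem isGalois_adjoin_rootSet [PerfectField C] :
    IsGalois C (IntermediateField.adjoin C (P.rootSet Ω)) := by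
  haveI := finiteDimensional_adjoin_rootSet_subfield (Ω := Ω) P
  haveI : Algebra.IsAlgebraic C (IntermediateField.adjoin C (P.rootSet Ω)) :=
    Algebra.IsAlgebraic.of_finite C _
  exact isGalois_iff.mpr ⟨inferInstance, normal_adjoin_rootSet_subfield P⟩

include hCE in
/-- `E(roots P)|E` is Galois when `C` is perfect. [folklore] -/
theorem isGalois_adjoin_rootSet_top [PerfectField C] :
    IsGalois E (IntermediateField.adjoin E (P.rootSet Ω)) := by
  refine isGalois_iff.mpr ⟨?_, normal_adjoin_rootSet_top_subfield hCE P⟩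
  refine (IntermediateField.isSeparable_adjoin_iff_isSeparable E Ω).mpr fun x hx => ?_
  exact isSeparable_of_subfield_le hCE
    (PerfectField.separable_of_irreducible (minpoly.irreducible (isIntegral_of_mem_rootSet' P hx)))

omit [IsAlgClosed Ω] in
include hCE in
/-- `C(roots P) ⊆ E(roots P)`. [folklore] -/
theorem coe_adjoin_rootSet_subset :
    ((IntermediateField.adjoin C (P.rootSet Ω) : IntermediateField C Ω) : Set Ω) ⊆
      (IntermediateField.adjoin E (P.rootSet Ω) : IntermediateField E Ω) :=
  coe_adjoin_subset_coe_adjoin hCE _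

omit [IsAlgClosed Ω] in
/-- **A common primitive element**: for `C` perfect there is `θ ∈ C(roots P)` with
`C(roots P) = C(θ)` and `E(roots P) = E(θ)`. [folklore] -/
theorem exists_adjoin_rootSet_eq_adjoin_simple [PerfectField C] (hCE : C ≤ E) :
    ∃ θ : Ω, θ ∈ IntermediateField.adjoin C (P.rootSet Ω) ∧
      IntermediateField.adjoin C ({θ} : Set Ω) = IntermediateField.adjoin C (P.rootSet Ω) ∧
      (IntermediateField.adjoin E ({θ} : Set Ω) : IntermediateField E Ω) =
        IntermediateField.adjoin E (P.rootSet Ω) := by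
  set L : IntermediateField C Ω := IntermediateField.adjoin C (P.rootSet Ω) with hLdef
  haveI : FiniteDimensional C L := finiteDimensional_adjoin_rootSet_subfield P
  haveI : Algebra.IsAlgebraic C L := Algebra.IsAlgebraic.of_finite C L
  obtain ⟨θ₀, hθ₀⟩ := Field.exists_primitive_element C L
  have hLθ : IntermediateField.adjoin C ({(θ₀ : Ω)} : Set Ω) = L := by
    simpa only [IntermediateField.lift_adjoin_simple, IntermediateField.lift_top] using
      congr_arg IntermediateField.lift hθ₀
  refine ⟨θ₀, θ₀.2, hLθ, le_antisymm ?_ ?_⟩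
  · rw [IntermediateField.adjoin_le_iff, Set.singleton_subset_iff]
    exact coe_adjoin_rootSet_subset hCE P θ₀.2
  · rw [IntermediateField.adjoin_le_iff]
    intro x hx
    have hxL : x ∈ L := IntermediateField.subset_adjoin C _ hx
    rw [← hLθ] at hxL
    exact coe_adjoin_subset_coe_adjoin hCE _ hxL

variable (hrel : ∀ a ∈ E, IsAlgebraic C a → a ∈ C)

include hCE hrel in
/-- **`[E(roots P) : E] = [C(roots P) : C]`** (Kuhlmann–Vlahu 2014, the degree equality of
Lemma 14.2, for root layers over a perfect `C` algebraically closed in `E`). [folklore] -/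
theorem finrank_adjoin_rootSet_top_eq [PerfectField C] :
    finrank E (IntermediateField.adjoin E (P.rootSet Ω)) =
      finrank C (IntermediateField.adjoin C (P.rootSet Ω)) := by
  obtain ⟨θ, hθL, hL, hM⟩ := exists_adjoin_rootSet_eq_adjoin_simple P hCE
  haveI : FiniteDimensional C (IntermediateField.adjoin C (P.rootSet Ω)) :=
    finiteDimensional_adjoin_rootSet_subfield P
  have hθ : IsIntegral C θ :=
    IntermediateField.isIntegral_iff.mp (Algebra.IsIntegral.isIntegral (⟨θ, hθL⟩ :
      IntermediateField.adjoin C (P.rootSet Ω)))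
  have hsep : IsSeparable C θ := PerfectField.separable_of_irreducible (minpoly.irreducible hθ)
  rw [← hL, ← hM]
  exact finrank_adjoin_simple_eq_of_forall_isAlgebraic_mem hCE hrel hθ hsep

include hCE hrel in
/-- **`E(roots P) ∩ C̃ = C(roots P)`**: an element of `E(roots P)` algebraic over the perfect `C`
lies in `C(roots P)`. [folklore] -/
theorem mem_adjoin_rootSet_of_isAlgebraic [PerfectField C] {a : Ω}
    (haM : a ∈ (IntermediateField.adjoin E (P.rootSet Ω) : IntermediateField E Ω))
    (ha : IsAlgebraic C a) : a ∈ IntermediateField.adjoin C (P.rootSet Ω) := by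
  obtain ⟨θ, hθL, hL, hM⟩ := exists_adjoin_rootSet_eq_adjoin_simple P hCE
  haveI : FiniteDimensional C (IntermediateField.adjoin C (P.rootSet Ω)) :=
    finiteDimensional_adjoin_rootSet_subfield P
  have hθ : IsIntegral C θ :=
    IntermediateField.isIntegral_iff.mp (Algebra.IsIntegral.isIntegral (⟨θ, hθL⟩ :
      IntermediateField.adjoin C (P.rootSet Ω)))
  rw [← hM] at haM
  rw [← hL]
  exact mem_adjoin_simple_of_isAlgebraic hCE hrel hθ haM ha

/-! ### Automorphisms of `E(roots P)|E` restrict to `C(roots P)|C` -/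

omit [IsAlgClosed Ω] in
include hCE in
/-- An `E`-automorphism of `E(roots P)` permutes the roots of `P`. [folklore] -/
theorem coe_algEquiv_apply_mem_rootSet (σ : (IntermediateField.adjoin E (P.rootSet Ω)) ≃ₐ[E] (IntermediateField.adjoin E (P.rootSet Ω))) {z : (IntermediateField.adjoin E (P.rootSet Ω))} (hz : (z : Ω) ∈ P.rootSet Ω) :
    ((σ z : (IntermediateField.adjoin E (P.rootSet Ω))) : Ω) ∈ P.rootSet Ω := by
  classical
  letI : Algebra C E := (Subfield.inclusion hCE).toAlgebra
  haveI : IsScalarTower C E Ω := IsScalarTower.of_algebraMap_eq fun _ => rfl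
  rw [Polynomial.mem_rootSet] at hz ⊢
  refine ⟨hz.1, ?_⟩
  have hPP' : ∀ x : Ω, aeval x (P.map (algebraMap C E)) = aeval x P := fun x =>
    Polynomial.aeval_map_algebraMap E x P
  have h1 : aeval z (P.map (algebraMap C E)) = 0 := by
    apply (algebraMap (IntermediateField.adjoin E (P.rootSet Ω)) Ω).injective
    rw [← Polynomial.aeval_algebraMap_apply, map_zero]
    change aeval (z : Ω) (P.map (algebraMap C E)) = 0
    rw [hPP']
    exact hz.2
  have h2 : aeval (σ z) (P.map (algebraMap C E)) = 0 := by
    change aeval ((σ : (IntermediateField.adjoin E (P.rootSet Ω)) →ₐ[E] (IntermediateField.adjoin E (P.rootSet Ω))) z) (P.map (algebraMap C E)) = 0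
    rw [Polynomial.aeval_algHom_apply, h1, map_zero]
  have h3 := congrArg (algebraMap (IntermediateField.adjoin E (P.rootSet Ω)) Ω) h2
  rw [← Polynomial.aeval_algebraMap_apply, map_zero] at h3
  change aeval ((σ z : (IntermediateField.adjoin E (P.rootSet Ω))) : Ω) (P.map (algebraMap C E)) = 0 at h3
  rwa [hPP'] at h3

omit [IsAlgClosed Ω] in
include hCE in
/-- An `E`-automorphism of `E(roots P)` maps `C(roots P)` into itself. [folklore] -/
theorem coe_algEquiv_apply_mem_adjoin_rootSet (σ : (IntermediateField.adjoin E (P.rootSet Ω)) ≃ₐ[E] (IntermediateField.adjoin E (P.rootSet Ω))) {z : (IntermediateField.adjoin E (P.rootSet Ω))} (hz : (z : Ω) ∈ (IntermediateField.adjoin C (P.rootSet Ω))) :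
    ((σ z : (IntermediateField.adjoin E (P.rootSet Ω))) : Ω) ∈ (IntermediateField.adjoin C (P.rootSet Ω)) := by
  -- the `w ∈ M` mapped by `σ` into `L` form a subfield containing `C` and the roots
  have key : ∀ w ∈ Subfield.closure ((C : Set Ω) ∪ P.rootSet Ω),
      ∃ hw : w ∈ (IntermediateField.adjoin E (P.rootSet Ω)), ((σ ⟨w, hw⟩ : (IntermediateField.adjoin E (P.rootSet Ω))) : Ω) ∈ (IntermediateField.adjoin C (P.rootSet Ω)) := by
    intro w hw
    refine Subfield.closure_induction (p := fun w _ => ∃ hw : w ∈ (IntermediateField.adjoin E (P.rootSet Ω)), ((σ ⟨w, hw⟩ : (IntermediateField.adjoin E (P.rootSet Ω))) : Ω) ∈ (IntermediateField.adjoin C (P.rootSet Ω)))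
      ?_ ?_ ?_ ?_ ?_ ?_ hw
    · rintro x (hxC | hxr)
      · refine ⟨((IntermediateField.adjoin E (P.rootSet Ω))).algebraMap_mem ⟨x, hCE hxC⟩, ?_⟩
        have : σ ⟨x, ((IntermediateField.adjoin E (P.rootSet Ω))).algebraMap_mem ⟨x, hCE hxC⟩⟩ = ⟨x, ((IntermediateField.adjoin E (P.rootSet Ω))).algebraMap_mem ⟨x, hCE hxC⟩⟩ :=
          σ.commutes (⟨x, hCE hxC⟩ : E)
        rw [this]
        exact ((IntermediateField.adjoin C (P.rootSet Ω))).algebraMap_mem ⟨x, hxC⟩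
      · refine ⟨IntermediateField.subset_adjoin E _ hxr, ?_⟩
        exact IntermediateField.subset_adjoin C _ (coe_algEquiv_apply_mem_rootSet hCE P σ hxr)
    · exact ⟨((IntermediateField.adjoin E (P.rootSet Ω))).one_mem, by rw [show (⟨1, ((IntermediateField.adjoin E (P.rootSet Ω))).one_mem⟩ : (IntermediateField.adjoin E (P.rootSet Ω))) = 1 from rfl, map_one]; exact ((IntermediateField.adjoin C (P.rootSet Ω))).one_mem⟩
    · rintro x y _ _ ⟨hx, hx'⟩ ⟨hy, hy'⟩
      refine ⟨((IntermediateField.adjoin E (P.rootSet Ω))).add_mem hx hy, ?_⟩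
      have : (⟨x + y, ((IntermediateField.adjoin E (P.rootSet Ω))).add_mem hx hy⟩ : (IntermediateField.adjoin E (P.rootSet Ω))) = ⟨x, hx⟩ + ⟨y, hy⟩ := rfl
      rw [this, map_add]
      exact ((IntermediateField.adjoin C (P.rootSet Ω))).add_mem hx' hy'
    · rintro x _ ⟨hx, hx'⟩
      refine ⟨((IntermediateField.adjoin E (P.rootSet Ω))).neg_mem hx, ?_⟩
      have : (⟨-x, ((IntermediateField.adjoin E (P.rootSet Ω))).neg_mem hx⟩ : (IntermediateField.adjoin E (P.rootSet Ω))) = -⟨x, hx⟩ := rfl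
      rw [this, map_neg]
      exact ((IntermediateField.adjoin C (P.rootSet Ω))).neg_mem hx'
    · rintro x _ ⟨hx, hx'⟩
      refine ⟨((IntermediateField.adjoin E (P.rootSet Ω))).inv_mem hx, ?_⟩
      have : (⟨x⁻¹, ((IntermediateField.adjoin E (P.rootSet Ω))).inv_mem hx⟩ : (IntermediateField.adjoin E (P.rootSet Ω))) = ⟨x, hx⟩⁻¹ := rfl
      rw [this, map_inv₀]
      exact ((IntermediateField.adjoin C (P.rootSet Ω))).inv_mem hx'
    · rintro x y _ _ ⟨hx, hx'⟩ ⟨hy, hy'⟩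
      refine ⟨((IntermediateField.adjoin E (P.rootSet Ω))).mul_mem hx hy, ?_⟩
      have : (⟨x * y, ((IntermediateField.adjoin E (P.rootSet Ω))).mul_mem hx hy⟩ : (IntermediateField.adjoin E (P.rootSet Ω))) = ⟨x, hx⟩ * ⟨y, hy⟩ := rfl
      rw [this, map_mul]
      exact ((IntermediateField.adjoin C (P.rootSet Ω))).mul_mem hx' hy'
  have hzc : (z : Ω) ∈ Subfield.closure ((C : Set Ω) ∪ P.rootSet Ω) := by
    rw [← mem_adjoin_subfield_iff]
    exact hz
  obtain ⟨hw, h⟩ := key (z : Ω) hzc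
  exact h

omit [IsAlgClosed Ω] in
include hCE in
/-- **Restriction to the root layer**: every `σ ∈ Gal(E(roots P)|E)` restricts to an element
`τ ∈ Gal(C(roots P)|C)`: `τ z = σ z` for `z ∈ C(roots P)`. [folklore] -/
theorem exists_restrict_algEquiv (σ : (IntermediateField.adjoin E (P.rootSet Ω)) ≃ₐ[E] (IntermediateField.adjoin E (P.rootSet Ω))) :
    ∃ τ : (IntermediateField.adjoin C (P.rootSet Ω)) ≃ₐ[C] (IntermediateField.adjoin C (P.rootSet Ω)), ∀ z : (IntermediateField.adjoin C (P.rootSet Ω)),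
      ((τ z : (IntermediateField.adjoin C (P.rootSet Ω))) : Ω) = ((σ ⟨z, coe_adjoin_rootSet_subset hCE P z.2⟩ : (IntermediateField.adjoin E (P.rootSet Ω))) : Ω) := by
  haveI : FiniteDimensional C (IntermediateField.adjoin C (P.rootSet Ω)) := finiteDimensional_adjoin_rootSet_subfield P
  have hLM : ∀ z : (IntermediateField.adjoin C (P.rootSet Ω)), (z : Ω) ∈ (IntermediateField.adjoin E (P.rootSet Ω)) := fun z => coe_adjoin_rootSet_subset hCE P z.2
  have hst : ∀ z : (IntermediateField.adjoin C (P.rootSet Ω)), ((σ ⟨z, hLM z⟩ : (IntermediateField.adjoin E (P.rootSet Ω))) : Ω) ∈ (IntermediateField.adjoin C (P.rootSet Ω)) := fun z =>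
    coe_algEquiv_apply_mem_adjoin_rootSet hCE P σ z.2
  let ψ : (IntermediateField.adjoin C (P.rootSet Ω)) →ₐ[C] (IntermediateField.adjoin C (P.rootSet Ω)) :=
    { toFun := fun z => ⟨_, hst z⟩
      map_one' := by
        apply Subtype.ext
        change ((σ ⟨((1 : (IntermediateField.adjoin C (P.rootSet Ω))) : Ω), hLM 1⟩ : (IntermediateField.adjoin E (P.rootSet Ω))) : Ω) = ((1 : (IntermediateField.adjoin C (P.rootSet Ω))) : Ω)
        rw [show (⟨((1 : (IntermediateField.adjoin C (P.rootSet Ω))) : Ω), hLM 1⟩ : (IntermediateField.adjoin E (P.rootSet Ω))) = 1 from rfl, map_one]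
        rfl
      map_mul' := fun x y => by
        apply Subtype.ext
        change ((σ ⟨((x * y : (IntermediateField.adjoin C (P.rootSet Ω))) : Ω), hLM (x * y)⟩ : (IntermediateField.adjoin E (P.rootSet Ω))) : Ω) =
          ((σ ⟨(x : Ω), hLM x⟩ : (IntermediateField.adjoin E (P.rootSet Ω))) : Ω) * ((σ ⟨(y : Ω), hLM y⟩ : (IntermediateField.adjoin E (P.rootSet Ω))) : Ω)
        rw [show (⟨((x * y : (IntermediateField.adjoin C (P.rootSet Ω))) : Ω), hLM (x * y)⟩ : (IntermediateField.adjoin E (P.rootSet Ω))) = ⟨(x : Ω), hLM x⟩ * ⟨(y : Ω), hLM y⟩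
          from rfl, map_mul]
        rfl
      map_zero' := by
        apply Subtype.ext
        change ((σ ⟨((0 : (IntermediateField.adjoin C (P.rootSet Ω))) : Ω), hLM 0⟩ : (IntermediateField.adjoin E (P.rootSet Ω))) : Ω) = ((0 : (IntermediateField.adjoin C (P.rootSet Ω))) : Ω)
        rw [show (⟨((0 : (IntermediateField.adjoin C (P.rootSet Ω))) : Ω), hLM 0⟩ : (IntermediateField.adjoin E (P.rootSet Ω))) = 0 from rfl, map_zero]
        rfl
      map_add' := fun x y => by
        apply Subtype.ext
        change ((σ ⟨((x + y : (IntermediateField.adjoin C (P.rootSet Ω))) : Ω), hLM (x + y)⟩ : (IntermediateField.adjoin E (P.rootSet Ω))) : Ω) =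
          ((σ ⟨(x : Ω), hLM x⟩ : (IntermediateField.adjoin E (P.rootSet Ω))) : Ω) + ((σ ⟨(y : Ω), hLM y⟩ : (IntermediateField.adjoin E (P.rootSet Ω))) : Ω)
        rw [show (⟨((x + y : (IntermediateField.adjoin C (P.rootSet Ω))) : Ω), hLM (x + y)⟩ : (IntermediateField.adjoin E (P.rootSet Ω))) = ⟨(x : Ω), hLM x⟩ + ⟨(y : Ω), hLM y⟩
          from rfl, map_add]
        rfl
      commutes' := fun c => by
        apply Subtype.ext
        change ((σ ⟨((algebraMap C (IntermediateField.adjoin C (P.rootSet Ω)) c : (IntermediateField.adjoin C (P.rootSet Ω))) : Ω), hLM _⟩ : (IntermediateField.adjoin E (P.rootSet Ω))) : Ω) = ((algebraMap C (IntermediateField.adjoin C (P.rootSet Ω)) c : (IntermediateField.adjoin C (P.rootSet Ω))) : Ω)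
        have h1 : (⟨((algebraMap C (IntermediateField.adjoin C (P.rootSet Ω)) c : (IntermediateField.adjoin C (P.rootSet Ω))) : Ω), hLM _⟩ : (IntermediateField.adjoin E (P.rootSet Ω))) = algebraMap E (IntermediateField.adjoin E (P.rootSet Ω)) ⟨c, hCE c.2⟩ := rfl
        rw [h1, σ.commutes]
        rfl }
  have hψ : ∀ z : (IntermediateField.adjoin C (P.rootSet Ω)), ((ψ z : (IntermediateField.adjoin C (P.rootSet Ω))) : Ω) = ((σ ⟨z, hLM z⟩ : (IntermediateField.adjoin E (P.rootSet Ω))) : Ω) := fun z => rfl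
  have hinj : Function.Injective ψ := ψ.toRingHom.injective
  have hbij : Function.Bijective ψ :=
    ⟨hinj, (LinearMap.injective_iff_surjective (f := ψ.toLinearMap)).mp hinj⟩
  refine ⟨AlgEquiv.ofBijective ψ hbij, fun z => ?_⟩
  rw [AlgEquiv.ofBijective_apply]
  exact hψ z

omit [IsAlgClosed Ω] in
/-- **An automorphism of `E(roots P)|E` is determined by its values on `C(roots P)`.**
[folklore] -/
theorem algEquiv_eq_of_forall_coe_apply_eq {σ σ' : (IntermediateField.adjoin E (P.rootSet Ω)) ≃ₐ[E] (IntermediateField.adjoin E (P.rootSet Ω))}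
    (h : ∀ z : (IntermediateField.adjoin E (P.rootSet Ω)), (z : Ω) ∈ (IntermediateField.adjoin C (P.rootSet Ω)) → σ z = σ' z) : σ = σ' := by
  -- `σ` and `σ'` agree on the generators `E ∪ roots` of `M`, hence on `M`
  have key : ∀ w ∈ Subfield.closure ((E : Set Ω) ∪ P.rootSet Ω),
      ∃ hw : w ∈ (IntermediateField.adjoin E (P.rootSet Ω)), σ ⟨w, hw⟩ = σ' ⟨w, hw⟩ := by
    intro w hw
    refine Subfield.closure_induction (p := fun w _ => ∃ hw : w ∈ (IntermediateField.adjoin E (P.rootSet Ω)), σ ⟨w, hw⟩ = σ' ⟨w, hw⟩)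
      ?_ ?_ ?_ ?_ ?_ ?_ hw
    · rintro x (hxE | hxr)
      · refine ⟨((IntermediateField.adjoin E (P.rootSet Ω))).algebraMap_mem ⟨x, hxE⟩, ?_⟩
        exact (σ.commutes (⟨x, hxE⟩ : E)).trans (σ'.commutes (⟨x, hxE⟩ : E)).symm
      · exact ⟨IntermediateField.subset_adjoin E _ hxr,
          h _ (IntermediateField.subset_adjoin C _ hxr)⟩
    · exact ⟨((IntermediateField.adjoin E (P.rootSet Ω))).one_mem, by rw [show (⟨1, ((IntermediateField.adjoin E (P.rootSet Ω))).one_mem⟩ : (IntermediateField.adjoin E (P.rootSet Ω))) = 1 from rfl, map_one, map_one]⟩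
    · rintro x y _ _ ⟨hx, hx'⟩ ⟨hy, hy'⟩
      refine ⟨((IntermediateField.adjoin E (P.rootSet Ω))).add_mem hx hy, ?_⟩
      have : (⟨x + y, ((IntermediateField.adjoin E (P.rootSet Ω))).add_mem hx hy⟩ : (IntermediateField.adjoin E (P.rootSet Ω))) = ⟨x, hx⟩ + ⟨y, hy⟩ := rfl
      rw [this, map_add, map_add, hx', hy']
    · rintro x _ ⟨hx, hx'⟩
      refine ⟨((IntermediateField.adjoin E (P.rootSet Ω))).neg_mem hx, ?_⟩
      have : (⟨-x, ((IntermediateField.adjoin E (P.rootSet Ω))).neg_mem hx⟩ : (IntermediateField.adjoin E (P.rootSet Ω))) = -⟨x, hx⟩ := rfl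
      rw [this, map_neg, map_neg, hx']
    · rintro x _ ⟨hx, hx'⟩
      refine ⟨((IntermediateField.adjoin E (P.rootSet Ω))).inv_mem hx, ?_⟩
      have : (⟨x⁻¹, ((IntermediateField.adjoin E (P.rootSet Ω))).inv_mem hx⟩ : (IntermediateField.adjoin E (P.rootSet Ω))) = ⟨x, hx⟩⁻¹ := rfl
      rw [this, map_inv₀, map_inv₀, hx']
    · rintro x y _ _ ⟨hx, hx'⟩ ⟨hy, hy'⟩
      refine ⟨((IntermediateField.adjoin E (P.rootSet Ω))).mul_mem hx hy, ?_⟩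
      have : (⟨x * y, ((IntermediateField.adjoin E (P.rootSet Ω))).mul_mem hx hy⟩ : (IntermediateField.adjoin E (P.rootSet Ω))) = ⟨x, hx⟩ * ⟨y, hy⟩ := rfl
      rw [this, map_mul, map_mul, hx', hy']
  apply AlgEquiv.ext
  intro w
  have hwc : (w : Ω) ∈ Subfield.closure ((E : Set Ω) ∪ P.rootSet Ω) := by
    rw [← mem_adjoin_subfield_iff]
    exact w.2
  obtain ⟨hw, heq⟩ := key (w : Ω) hwc
  exact heq

end Layers

end Literature.AlgebraicGeometry.Resolution

end
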